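import Summits.PneNP.PneNP.Theses.WitnessForging
import Literature.Computability.Complexity.RandomKSatThresholdProofs

-- every `Summit.PneNP.PneNP.…` name repeats the summit = sub-problem component (layout D-0017)
set_option linter.dupNamespace false

/-!
# Skeleton (birth file) for the piece `WindowSatisfiable` (stmt-PneNP-17539) of the BC2 redirect of
# `ForgingThesis` (stmt-PneNP-2430), route PneNP/WitnessForging

`WindowSatisfiable`: `∃ k₁, ∀ k ≥ k₁, ∀ α, 2α ≤ 2^k → ∃ ε > 0, ∀ᶠ n, ε ≤ Pr_{Φ ∼ randomKCNF k n ⌊αn⌋}[Φ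
satisfiable]` — Achlioptas–Peres 2004 Thm 2 in the PROPER-CLAUSE model. The theorem is in the tree
for the with-replacement literal-array model (`AchlioptasPeres2004_threshold_lower_bound_holds`,
`RandomKSatThresholdProofs.lean`); the three stubs below are the model transfer, and
`WindowSatisfiable_of` (kernel-checked, no `sorry` outside the stubs) composes them with the tree
theorem.

* `stub_unsat_transfer` — conditioning on properness: for `k ≤ n`,
  `Pr_{randomKCNF k n m}[UNSAT] ≤ (1 − litArraySatProb k n m) / (n^(k)↓ / n^k)^m`
  (under the product event "every clause has `k` distinct variables" the literal array, read
  clause-wise as an element of `kClauses k n` — `k!`-to-1 with uniform fibres —, is distributed as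
  `randomKCNF k n m`, and satisfiability depends only on the literal sets; `n^(k)↓ / n^k` is the
  probability that `k` i.i.d. uniform variables are distinct).
* `stub_proper_prob_lower` — `(n^(k)↓ / n^k)^{⌊αn⌋} ≥ c(k, α) > 0` for all large `n`
  (`∏_{j<k} (1 − j/n) ≥ 1 − k²/n` and `(1 − k²/n)^{αn} → e^{−αk²}`).
* `stub_half_below_bound` — the top of the window is below the Achlioptas–Peres bound for large `k`:
  `2^k/2 < 2^k ln 2 − (k+1) ln 2/2 − 1 − δ_k` eventually, for any `δ_k → 0` (`ln 2 > 1/2`,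
  `Real.log_two_gt_d9`).

Composition: for `k ≥ k₁` (from stub 3 applied to the `δ` of the tree theorem) and `2α ≤ 2^k`: if
`α ≤ 0` the formula is empty (`randomKCNF_zero_clauses`) and `ε = 1`; otherwise `α < r`-bound, so
`litArraySatProb k n ⌊αn⌋ → 1`, hence eventually `1 − P < c/2 ≤ (n^(k)↓/n^k)^m / 2` and
`Pr[UNSAT] ≤ 1/2`, i.e. `Pr[SAT] ≥ 1/2 = ε` (`mass_add_mass_not`).
-/

namespace Summit.PneNP.PneNP.Cruxes.ForgingThesis.SplitBirthWindowSatisfiable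

open Literature.Computability.Complexity Filter Summit.PneNP.PneNP.Theses.WitnessForging

/-! ### Stubs -/

/-- **Stub 1 (model transfer by conditioning on proper clauses).** For `k ≤ n`, the UNSAT mass of the
proper-clause ensemble `randomKCNF k n m` is at most the UNSAT probability of the literal-array model
divided by the probability `(n^(k)↓ / n^k)^m` that all `m` clauses of a literal array are proper.
[cite: AchlioptasPeres2004, §3 footnote † (all common models)] -/
theorem stub_unsat_transfer : ∀ k n m : ℕ, k ≤ n →
    ((randomKCNF k n m).toOuterMeasure {φ | ¬ φ.Satisfiable}).toReal ≤
      (1 - litArraySatProb k n m) / (((n.descFactorial k : ℝ) / (n : ℝ) ^ k) ^ m) := by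
  sorry

/-- **Stub 2 (properness has uniformly positive probability at linear density).** For fixed `k` and
`α`, `(n^(k)↓ / n^k)^{⌊αn⌋} ≥ c > 0` for all large `n`. [folklore] -/
theorem stub_proper_prob_lower : ∀ (k : ℕ) (α : ℝ), ∃ c : ℝ, 0 < c ∧ ∀ᶠ n : ℕ in atTop,
    c ≤ (((n.descFactorial k : ℝ) / (n : ℝ) ^ k)) ^ ⌊α * n⌋₊ := by
  sorry

/-- **Stub 3 (the window top is below the Achlioptas–Peres bound).** For every null sequence `δ`
there is `k₁ ≥ 3` with `2^k/2 < 2^k ln 2 − (k+1) ln 2/2 − 1 − δ_k` for all `k ≥ k₁`.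
[cite: AchlioptasPeres2004, Thm 2] -/
theorem stub_half_below_bound : ∀ δ : ℕ → ℝ, Tendsto δ atTop (nhds 0) → ∃ k₁ : ℕ, 3 ≤ k₁ ∧
    ∀ k ≥ k₁, (2 : ℝ) ^ k / 2 < 2 ^ k * Real.log 2 - ((k : ℝ) + 1) * Real.log 2 / 2 - 1 - δ k := by
  sorry

/-! ### Mass bookkeeping -/

/-- `Pr[p ∈ s] + Pr[p ∉ s] = 1` for a `PMF`. [folklore] -/
theorem mass_add_mass_not {β : Type} (p : PMF β) (P : β → Prop) :
    p.toOuterMeasure {x | P x} + p.toOuterMeasure {x | ¬ P x} = 1 := by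
  rw [PMF.toOuterMeasure_apply, PMF.toOuterMeasure_apply, ← ENNReal.tsum_add, ← p.tsum_coe]
  refine tsum_congr fun x => ?_
  by_cases hx : P x
  · rw [Set.indicator_of_mem (show x ∈ {x | P x} from hx),
      Set.indicator_of_notMem (show x ∉ {x | ¬ P x} from fun h => h hx), add_zero]
  · rw [Set.indicator_of_notMem (show x ∉ {x | P x} from hx),
      Set.indicator_of_mem (show x ∈ {x | ¬ P x} from hx), zero_add]

/-- Hence the real masses add to `1`. [folklore] -/
theorem toReal_mass_eq_one_sub {β : Type} (p : PMF β) (P : β → Prop) :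
    (p.toOuterMeasure {x | P x}).toReal = 1 - (p.toOuterMeasure {x | ¬ P x}).toReal := by
  have h := mass_add_mass_not p P
  have h1 : p.toOuterMeasure {x | P x} ≠ ⊤ :=
    ((le_of_le_of_eq le_self_add h).trans_lt ENNReal.one_lt_top).ne
  have h2 : p.toOuterMeasure {x | ¬ P x} ≠ ⊤ :=
    ((le_of_le_of_eq le_add_self h).trans_lt ENNReal.one_lt_top).ne
  have h3 := congrArg ENNReal.toReal h
  rw [ENNReal.toReal_add h1 h2, ENNReal.toReal_one] at h3
  linarith

/-! ### Composition -/

/-- **`WindowSatisfiable` from the three stubs and the tree theorem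
`AchlioptasPeres2004_threshold_lower_bound_holds`.** [cite: AchlioptasPeres2004, Thm 2] -/
theorem WindowSatisfiable_of
    (h1 : ∀ k n m : ℕ, k ≤ n →
      ((randomKCNF k n m).toOuterMeasure {φ | ¬ φ.Satisfiable}).toReal ≤
        (1 - litArraySatProb k n m) / (((n.descFactorial k : ℝ) / (n : ℝ) ^ k) ^ m))
    (h2 : ∀ (k : ℕ) (α : ℝ), ∃ c : ℝ, 0 < c ∧ ∀ᶠ n : ℕ in atTop,
      c ≤ (((n.descFactorial k : ℝ) / (n : ℝ) ^ k)) ^ ⌊α * n⌋₊)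
    (h3 : ∀ δ : ℕ → ℝ, Tendsto δ atTop (nhds 0) → ∃ k₁ : ℕ, 3 ≤ k₁ ∧
      ∀ k ≥ k₁, (2 : ℝ) ^ k / 2 < 2 ^ k * Real.log 2 - ((k : ℝ) + 1) * Real.log 2 / 2 - 1 - δ k) :
    WindowSatisfiable := by
  obtain ⟨δ, hδ, hAP⟩ := AchlioptasPeres2004_threshold_lower_bound_holds
  obtain ⟨k₁, hk₁3, hk₁⟩ := h3 δ hδ
  refine ⟨k₁, fun k hk α hα => ?_⟩
  by_cases hα0 : α ≤ 0
  · -- no clauses: the empty formula is satisfiable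
    refine ⟨1, one_pos, Filter.Eventually.of_forall fun n => ?_⟩
    have hm : ⌊α * (n : ℝ)⌋₊ = 0 :=
      Nat.floor_of_nonpos (mul_nonpos_of_nonpos_of_nonneg hα0 (Nat.cast_nonneg n))
    rw [hm, randomKCNF_zero_clauses, PMF.toOuterMeasure_pure_apply,
      if_pos (show ([] : CNF ℕ) ∈ {φ : CNF ℕ | φ.Satisfiable} from CNF.satisfiable_nil)]
    simp
  · push Not at hα0
    have hr : α < 2 ^ k * Real.log 2 - ((k : ℝ) + 1) * Real.log 2 / 2 - 1 - δ k :=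
      lt_of_le_of_lt (by linarith) (hk₁ k hk)
    have hT := hAP k (hk₁3.trans hk) α hr
    obtain ⟨c, hc, hevc⟩ := h2 k α
    refine ⟨1 / 2, by norm_num, ?_⟩
    have hev1 : ∀ᶠ n : ℕ in atTop, 1 - c / 2 < litArraySatProb k n ⌊α * n⌋₊ :=
      hT.eventually_const_lt (by linarith)
    filter_upwards [hev1, hevc, eventually_ge_atTop k] with n hn1 hn2 hn3
    have hU := h1 k n ⌊α * n⌋₊ hn3
    have hpos : 0 < (((n.descFactorial k : ℝ) / (n : ℝ) ^ k)) ^ ⌊α * (n : ℝ)⌋₊ := hc.trans_le hn2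
    have hU' : ((randomKCNF k n ⌊α * (n : ℝ)⌋₊).toOuterMeasure {φ | ¬ φ.Satisfiable}).toReal ≤ 1 / 2 := by
      refine hU.trans ?_
      rw [div_le_iff₀ hpos]
      nlinarith
    rw [toReal_mass_eq_one_sub]
    linarith

end Summit.PneNP.PneNP.Cruxes.ForgingThesis.SplitBirthWindowSatisfiable
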